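import Summits.QuantumFields.YangMills.Theorems.MirrorModularBoostsHypercubicLimitClosureHalvesDefs
import Summits.QuantumFields.YangMills.Theorems.LangevinControlUVOSLegsAtWeakCouplingCDefs
import HarnessLib

/-!
# Crux `WeakCouplingHypercubicLimit` (stmt-QuantumFields-16120), line `Sketch`, r10 toolkit: thermal bookkeeping
(sub-goal SG-E `thermal_bookkeeping`)

Helper file of the lead (c4) for the r10 skeleton `Cruxes/WeakCouplingHypercubicLimit/Lines/Sketch.lean`.  The
skeleton derives the continuum mass gap from the lattice RP-spectral clustering `RPSpectral r sch Δ C`, whose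
THERMAL error term is `C B² e^{−Δ a_k L_k}` with `B` the sup of the smeared functional and `L_k` the torus
half-side.  Two pieces of bookkeeping are isolated here:

* (i) counting lattice multipoints in a support ball: if `tsupport F ⊆ closedBall 0 ρ` (sup norm over the `n`
  slots of Euclidean norms), then every multipoint `y ∈ (box 4 L)ⁿ` with `F (a • y) ≠ 0` has all `4n` integer
  coordinates of modulus `≤ ρ / a` (`|y l μ| ≤ ‖y l‖ ≤ ‖y‖ ≤ ρ / a`), hence lies in `(box 4 ⌊ρ/a⌋₊)ⁿ`, a set of
  `(2⌊ρ/a⌋₊ + 1)^{4n} ≤ (2ρ/a + 3)^{4n}` elements; each term is `≤ |F|_{0,0}` (`SchwartzMap.norm_le_seminorm`);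
* (ii) death of the thermal term along a scheme with polynomial volume growth (`PolyVolume sch`:
  `a_k⁻¹ ≤ (a_k L_k)^N` eventually): `|C a_k^{-p} (a_k L_k)^{p'} e^{−Δ a_k L_k}| ≤ |C| (a_k L_k)^{Np+p'} e^{−Δ a_k L_k}
  → 0` since `a_k L_k → ∞` (`SpeciesScheme.tendsto_L`) and `x^m e^{−x} → 0`
  (`Real.tendsto_pow_mul_exp_neg_atTop_nhds_zero`, rescaled by `Δ`).

Refs: Glimm–Jaffe 1987 §6.1, §19 (thermal/finite-volume error of the transfer matrix); Friedli–Velenik 2017 §3.2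
(boxes `B(n)`).
-/

noncomputable section

open scoped SchwartzMap BigOperators ComplexConjugate
open MeasureTheory Filter Topology
open Literature.MathematicalPhysics.QuantumFieldTheory Literature.MathematicalPhysics.QuantumLattice
open Literature.MathematicalPhysics.AQFT
open Literature.Probability.LatticeModels (box Site)
open Summit.QuantumFields.YangMills.Cruxes.HypercubicLimit.CouplingResponse
open Summit.QuantumFields.YangMills.Cruxes.OSLegsFromFemtoAndGap.DlrCollarTransfer (plane conn Decay RPPos ConnCS)
open Summit.QuantumFields.YangMills.Cruxes.OSLegsAtWeakCouplingC.Sketch (Separated)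
open Summit.QuantumFields.YangMills.Theorems.OSLegsFromFemtoAndGap

namespace Summit.QuantumFields.YangMills.Theorems.WeakCouplingHypercubicLimit.TraceNormColdPressure

/-- Support bookkeeping: if `tsupport F ⊆ closedBall 0 ρ` and `F (a • y) ≠ 0` (`a > 0`), then every integer
coordinate of the multipoint `y` has modulus `≤ ⌊ρ / a⌋₊`, i.e. `y ∈ (box 4 ⌊ρ/a⌋₊)ⁿ`. [folklore] -/
theorem thermal_bookkeeping_mem_piFinset_box {n : ℕ} (F : 𝓢((Fin n → EuclideanSpace ℝ (Fin 4)), ℂ))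
    {ρ a : ℝ} (ha : 0 < a)
    (hsupp : tsupport (F : (Fin n → EuclideanSpace ℝ (Fin 4)) → ℂ) ⊆ Metric.closedBall 0 ρ)
    {y : Fin n → Site 4} (hy : F (fun l => a • siteToE (y l)) ≠ 0) :
    y ∈ Fintype.piFinset fun _ : Fin n => box 4 ⌊ρ / a⌋₊ := by
  have hx : (fun l => a • siteToE (y l)) ∈
      Metric.closedBall (0 : Fin n → EuclideanSpace ℝ (Fin 4)) ρ :=
    hsupp (subset_tsupport _ (Function.mem_support.2 hy))
  rw [Metric.mem_closedBall, dist_zero_right] at hx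
  rw [Fintype.mem_piFinset]
  intro l
  rw [Literature.Probability.LatticeModels.mem_box]
  intro i
  have h1 : ‖a • siteToE (y l)‖ ≤ ρ := (norm_le_pi_norm (fun l => a • siteToE (y l)) l).trans hx
  rw [norm_smul, Real.norm_of_nonneg ha.le] at h1
  have h2 : |((y l i : ℤ) : ℝ)| ≤ ρ / a := by
    rw [le_div_iff₀' ha]
    refine le_trans ?_ h1
    have h3 : ‖siteToE (y l) i‖ ≤ ‖siteToE (y l)‖ := PiLp.norm_apply_le (siteToE (y l)) i
    rw [siteToE_apply, Real.norm_eq_abs] at h3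
    exact mul_le_mul_of_nonneg_left h3 ha.le
  have h3 : ((y l i).natAbs : ℝ) ≤ ρ / a := by
    rw [Nat.cast_natAbs, Int.cast_abs]
    exact h2
  have h4 : (y l i).natAbs ≤ ⌊ρ / a⌋₊ := Nat.le_floor h3
  omega

/-- **Part (i) of `thermal_bookkeeping`**: the number of lattice multipoints `y ∈ (box 4 L)ⁿ` at which a test
function supported in the closed `ρ`-ball can be non-zero when sampled at spacing `a` is at most
`(2ρ/a + 3)^{4n}`, and each term is bounded by the sup seminorm `|F|_{0,0}`. [folklore] -/
theorem thermal_bookkeeping_sum_le (n : ℕ) (F : 𝓢((Fin n → EuclideanSpace ℝ (Fin 4)), ℂ)) (ρ a : ℝ) (L : ℕ)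
    (ha : 0 < a) (hρ : 0 ≤ ρ)
    (hsupp : tsupport (F : (Fin n → EuclideanSpace ℝ (Fin 4)) → ℂ) ⊆ Metric.closedBall 0 ρ) :
    ∑ y ∈ Fintype.piFinset (fun _ : Fin n => box 4 L), ‖F (fun l => a • siteToE (y l))‖ ≤
      (2 * ρ / a + 3) ^ (4 * n) * SchwartzMap.seminorm ℂ 0 0 F := by
  classical
  set S : Finset (Fin n → Site 4) := Fintype.piFinset fun _ : Fin n => box 4 ⌊ρ / a⌋₊ with hS
  set g : (Fin n → Site 4) → ℝ := fun y => ‖F (fun l => a • siteToE (y l))‖ with hg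
  have hg0 : ∀ y, 0 ≤ g y := fun y => norm_nonneg _
  calc ∑ y ∈ Fintype.piFinset (fun _ : Fin n => box 4 L), g y
      = ∑ y ∈ (Fintype.piFinset (fun _ : Fin n => box 4 L)).filter (fun y => g y ≠ 0), g y :=
        (Finset.sum_filter_ne_zero _).symm
    _ ≤ ∑ y ∈ S, g y := by
        refine Finset.sum_le_sum_of_subset_of_nonneg ?_ (fun y _ _ => hg0 y)
        intro y hy
        rw [Finset.mem_filter] at hy
        refine thermal_bookkeeping_mem_piFinset_box F ha hsupp (fun h => hy.2 ?_)
        simp [hg, h]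
    _ ≤ S.card • SchwartzMap.seminorm ℂ 0 0 F :=
        Finset.sum_le_card_nsmul _ _ _ (fun y _ => SchwartzMap.norm_le_seminorm ℂ F _)
    _ = (2 * (⌊ρ / a⌋₊ : ℝ) + 1) ^ (4 * n) * SchwartzMap.seminorm ℂ 0 0 F := by
        rw [nsmul_eq_mul, hS, Fintype.card_piFinset_const, Literature.Probability.LatticeModels.card_box,
          ← pow_mul]
        push_cast
        ring
    _ ≤ (2 * ρ / a + 3) ^ (4 * n) * SchwartzMap.seminorm ℂ 0 0 F := by
        have hfl : (⌊ρ / a⌋₊ : ℝ) ≤ ρ / a := Nat.floor_le (div_nonneg hρ ha.le)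
        have hle : 2 * (⌊ρ / a⌋₊ : ℝ) + 1 ≤ 2 * ρ / a + 3 := by
          rw [mul_div_assoc]
          linarith
        have h0 : 0 ≤ SchwartzMap.seminorm ℂ 0 0 F := apply_nonneg _ _
        gcongr

/-- **Part (ii) of `thermal_bookkeeping`**: along a scheme with polynomial volume growth (`PolyVolume sch`,
`a_k⁻¹ ≤ (a_k L_k)^N` eventually) the thermal term `C a_k^{-p} (a_k L_k)^{p'} e^{−Δ a_k L_k}` dies:
`a_k L_k → ∞` and `x^m e^{−Δ x} → 0`. [folklore] -/
theorem thermal_bookkeeping_tendsto {ι : Type} (sch : SpeciesScheme ι) (hV : PolyVolume sch) (Δ : ℝ)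
    (hΔ : 0 < Δ) (p p' : ℕ) (C : ℝ) :
    Tendsto (fun k => C * (sch.a k)⁻¹ ^ p * (sch.a k * sch.L k) ^ p' * Real.exp (-(Δ * sch.a k * sch.L k)))
      atTop (𝓝 0) := by
  obtain ⟨N, -, hN⟩ := hV
  have hu : Tendsto (fun k => sch.a k * (sch.L k : ℝ)) atTop atTop := sch.tendsto_L
  -- the comparison function `|C| (a L)^{Np+p'} e^{-Δ a L} → 0`
  have hlim : Tendsto (fun k => |C| * ((sch.a k * (sch.L k : ℝ)) ^ (N * p + p') *
      Real.exp (-(Δ * sch.a k * sch.L k)))) atTop (𝓝 0) := by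
    have h0 := ((Real.tendsto_pow_mul_exp_neg_atTop_nhds_zero (N * p + p')).comp
      (hu.const_mul_atTop hΔ)).const_mul (|C| * Δ⁻¹ ^ (N * p + p'))
    rw [mul_zero] at h0
    -- undo the rescaling by `Δ`
    have hc : ∀ x : ℝ, |C| * Δ⁻¹ ^ (N * p + p') * ((Δ * x) ^ (N * p + p') * Real.exp (-(Δ * x))) =
        |C| * (x ^ (N * p + p') * Real.exp (-(Δ * x))) := by
      intro x
      have h1 : Δ⁻¹ ^ (N * p + p') * Δ ^ (N * p + p') = 1 := by
        rw [← mul_pow, inv_mul_cancel₀ hΔ.ne', one_pow]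
      calc |C| * Δ⁻¹ ^ (N * p + p') * ((Δ * x) ^ (N * p + p') * Real.exp (-(Δ * x)))
          = |C| * (Δ⁻¹ ^ (N * p + p') * Δ ^ (N * p + p')) * (x ^ (N * p + p') * Real.exp (-(Δ * x))) := by
            rw [mul_pow]; ring
        _ = |C| * (x ^ (N * p + p') * Real.exp (-(Δ * x))) := by rw [h1, mul_one]
    refine h0.congr fun k => ?_
    simp only [Function.comp_apply]
    rw [hc, mul_assoc Δ]
  refine squeeze_zero_norm' ?_ hlim
  filter_upwards [hN, hu.eventually_ge_atTop 1] with k hk hk1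
  have hak : 0 < sch.a k := sch.a_pos k
  have ha0 : 0 ≤ (sch.a k)⁻¹ := inv_nonneg.2 hak.le
  have hu0 : 0 ≤ sch.a k * (sch.L k : ℝ) := zero_le_one.trans hk1
  have h1 : (sch.a k)⁻¹ ^ p ≤ (sch.a k * (sch.L k : ℝ)) ^ (N * p) := by
    rw [pow_mul]
    exact pow_le_pow_left₀ ha0 hk p
  rw [Real.norm_eq_abs, abs_mul, abs_mul, abs_mul, Real.abs_exp, abs_of_nonneg (pow_nonneg ha0 _),
    abs_of_nonneg (pow_nonneg hu0 _)]
  have key : (sch.a k)⁻¹ ^ p * (sch.a k * (sch.L k : ℝ)) ^ p' * Real.exp (-(Δ * sch.a k * sch.L k)) ≤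
      (sch.a k * (sch.L k : ℝ)) ^ (N * p) * (sch.a k * (sch.L k : ℝ)) ^ p' *
        Real.exp (-(Δ * sch.a k * sch.L k)) :=
    mul_le_mul_of_nonneg_right (mul_le_mul_of_nonneg_right h1 (pow_nonneg hu0 _)) (Real.exp_pos _).le
  calc |C| * (sch.a k)⁻¹ ^ p * (sch.a k * (sch.L k : ℝ)) ^ p' * Real.exp (-(Δ * sch.a k * sch.L k))
      = |C| * ((sch.a k)⁻¹ ^ p * (sch.a k * (sch.L k : ℝ)) ^ p' * Real.exp (-(Δ * sch.a k * sch.L k))) := by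
        ring
    _ ≤ |C| * ((sch.a k * (sch.L k : ℝ)) ^ (N * p) * (sch.a k * (sch.L k : ℝ)) ^ p' *
        Real.exp (-(Δ * sch.a k * sch.L k))) := mul_le_mul_of_nonneg_left key (abs_nonneg C)
    _ = |C| * ((sch.a k * (sch.L k : ℝ)) ^ (N * p + p') * Real.exp (-(Δ * sch.a k * sch.L k))) := by
        rw [pow_add]

/-- **Registered sub-goal `thermal_bookkeeping` (SG-E, line `Sketch`, r10 toolkit): bookkeeping.**  (i) Lattice
multipoints in a support ball: for `F` supported in the closed `ρ`-ball (sup norm of the slot Euclidean norms),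
`∑_{y ∈ (box 4 L)ⁿ} ‖F (a • y)‖ ≤ (2ρ/a + 3)^{4n} |F|_{0,0}`; (ii) death of the thermal term
`C a_k^{-p} (a_k L_k)^{p'} e^{−Δ a_k L_k} → 0` along a scheme with polynomial volume growth. [folklore] -/
theorem thermal_bookkeeping :
    (∀ (n : ℕ) (F : 𝓢((Fin n → EuclideanSpace ℝ (Fin 4)), ℂ)) (ρ a : ℝ) (L : ℕ), 0 < a → 0 ≤ ρ →
      tsupport (F : (Fin n → EuclideanSpace ℝ (Fin 4)) → ℂ) ⊆ Metric.closedBall 0 ρ →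
      ∑ y ∈ Fintype.piFinset (fun _ : Fin n => box 4 L), ‖F (fun l => a • siteToE (y l))‖ ≤
        (2 * ρ / a + 3) ^ (4 * n) * SchwartzMap.seminorm ℂ 0 0 F) ∧
    (∀ {ι : Type} (sch : SpeciesScheme ι), PolyVolume sch → ∀ (Δ : ℝ), 0 < Δ → ∀ (p p' : ℕ) (C : ℝ),
      Tendsto (fun k => C * (sch.a k)⁻¹ ^ p * (sch.a k * sch.L k) ^ p' * Real.exp (-(Δ * sch.a k * sch.L k)))
        atTop (𝓝 0)) :=
  ⟨thermal_bookkeeping_sum_le, fun sch hV Δ hΔ p p' C => thermal_bookkeeping_tendsto sch hV Δ hΔ p p' C⟩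

end Summit.QuantumFields.YangMills.Theorems.WeakCouplingHypercubicLimit.TraceNormColdPressure

end
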